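import Literature.IUT.HodgeTheaters.TruncatedPlaceKitBridge
import Mathlib.RingTheory.DedekindDomain.Factorization
import Mathlib.Data.Set.Finite.Lattice
import HarnessLib

/-!
# Admissible truncations are COFINAL: the truncated place-kit bridges exhaust `V̲` (RULING D13 (α))

Mochizuki, *Inter-universal Teichmüller Theory I*, kurims manuscript (May 2020), Def 3.1 (b), (e) pp.61–62
[cite: Mochizuki2012, I Def 3.1 (e) p.62] (D-0012 claim key, status disputed; nothing of the series is
asserted — classical algebraic number theory about the typed definition, PROVED).

Companion of `TruncatedPlaceKitBridge.lean` (merge canon C9-d, L6-lead RULING D13, L5-lead 22:11:27Z/22:11:48Z):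
the recorded weakening of reading `[Fintype V]`-indexed decls «for every admissible finite truncation `S` of
`V̲`» loses no PLACE of `V̲` — every finite set of indices, in particular every single valuation `v̲ ∈ V̲`, lies in
some ADMISSIBLE truncation (`InitialThetaData.IsAdmissibleTruncation`: finite, `⊇ V^bad_mod`, `⊇` the
archimedean places, fibre-complete over `V(ℚ)`), because the fibres of `V(F_mod) ↠ V(ℚ)` are finite
(finitely many archimedean places; finitely many primes of `𝓞_{F_mod}` over a rational prime — Dedekind
factorisation) and `V^bad_mod` is finite (`InitialThetaData.VbadMod_finite`). Consequently the admissible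
truncations `V̲_S` cover `V̲` (`iUnion_VOver_admissible`), so the family of truncated kits `S ↦ kit(V̲_S)` sees
every valuation of the initial Θ-data.
-/

namespace Literature.IUT.HodgeTheaters

open NumberField IsDedekindDomain

universe u v w

namespace Val

variable {M : Type v} [Field M] [NumberField M]

/-- `Val.restrict` on a nonarchimedean valuation, unfolded (plumbing). [folklore] -/
private theorem restrict_rat_non (w : FinitePlace M) :
    Val.restrict ℚ (Val.non w) =
      Val.non (FinitePlace.mk ((FinitePlace.maximalIdeal w).under (𝓞 ℚ))) := rfl

/-- **The fibres of `V(M) ↠ V(ℚ)` are finite** for a number field `M`: over the archimedean place of `ℚ`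
there are the finitely many archimedean places of `M` (the `r₁ + r₂` embeddings up to conjugation), over a prime
`p` the finitely many primes `𝔭₁, …, 𝔭_r` of `𝓞_M` in `p𝓞_M = 𝔭₁^{e₁}⋯𝔭_r^{e_r}` (Dedekind factorisation; here
via `Ideal.finite_factors`). PROVED. [cite: NeukirchANT1999, Ch. I Prop. 8.1 / (8.2); Ch. III §1] -/
theorem restrict_rat_fibre_finite (u : Val ℚ) : {w : Val M | Val.restrict ℚ w = u}.Finite := by
  classical
  rcases u with u | u
  · refine (Set.finite_range (Val.arc : InfinitePlace M → Val M)).subset ?_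
    rintro (w | w) hw
    · exact ⟨w, rfl⟩
    · exact absurd hw (by simp [Val.restrict])
  · -- nonarchimedean: primes over `P := maximalIdeal u`
    set P : HeightOneSpectrum (𝓞 ℚ) := FinitePlace.maximalIdeal u with hP
    have hinj : Function.Injective (algebraMap (𝓞 ℚ) (𝓞 M)) :=
      NumberField.RingOfIntegers.algebraMap.injective ℚ M
    have hne : Ideal.map (algebraMap (𝓞 ℚ) (𝓞 M)) P.asIdeal ≠ ⊥ :=
      fun h => P.ne_bot ((Ideal.map_eq_bot_iff_of_injective hinj).mp h)
    have hfin : {v : HeightOneSpectrum (𝓞 M) |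
        v.asIdeal ∣ Ideal.map (algebraMap (𝓞 ℚ) (𝓞 M)) P.asIdeal}.Finite :=
      Ideal.finite_factors hne
    have hpre : ((fun w : FinitePlace M => FinitePlace.maximalIdeal w) ⁻¹'
        {v : HeightOneSpectrum (𝓞 M) | v.asIdeal ∣ Ideal.map (algebraMap (𝓞 ℚ) (𝓞 M)) P.asIdeal}).Finite :=
      hfin.preimage FinitePlace.maximalIdeal_injective.injOn
    refine (hpre.image Val.non).subset ?_
    rintro (w | w) hw
    · exact absurd hw (by simp [Val.restrict])
    · refine ⟨w, ?_, rfl⟩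
      have hw0 : Val.restrict ℚ (Sum.inr w : Val M) = Sum.inr u := hw
      have hw' : FinitePlace.mk ((FinitePlace.maximalIdeal w).under (𝓞 ℚ)) = u :=
        Sum.inr_injective hw0
      have hunder : (FinitePlace.maximalIdeal w).under (𝓞 ℚ) = P := by
        rw [hP, ← hw', FinitePlace.maximalIdeal_mk]
      change (FinitePlace.maximalIdeal w).asIdeal ∣ Ideal.map (algebraMap (𝓞 ℚ) (𝓞 M)) P.asIdeal
      rw [Ideal.dvd_iff_le, ← hunder]
      exact Ideal.map_comap_le

/-- The archimedean valuations of a number field form a finite set (the `r₁ + r₂` infinite primes). PROVED.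
[cite: NeukirchANT1999, Ch. III §1] -/
theorem setOf_isArc_finite (M : Type v) [Field M] [NumberField M] : {v : Val M | v.IsArc}.Finite := by
  refine (Set.finite_range (Val.arc : InfinitePlace M → Val M)).subset ?_
  rintro (v | v) hv
  · exact ⟨v, rfl⟩
  · exact absurd hv (by simp [Val.IsArc])

end Val

section Places

variable {F : Type u} {K : Type v} {Fbar : Type w} [Field F] [NumberField F] [Field K]
  [NumberField K] [Algebra F K] [Field Fbar] [Algebra F Fbar] [Algebra K Fbar]
  {E : WeierstrassCurve F} [E.IsElliptic] {l : ℕ} {P : BadPlacePredicates K}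
  (D : InitialThetaData F K Fbar E l P)

namespace InitialThetaData

/-- **IUTchI:Def3.1(e)** (kurims p.62) **Admissible truncations are cofinal**: every finite set `S₀ ⊆ V_mod` of indices is contained in an
ADMISSIBLE truncation (take the union of the fibres over `V(ℚ)` of `S₀ ∪ V^bad_mod ∪ V_mod^arc` — finite by
`Val.restrict_rat_fibre_finite`, `VbadMod_finite` and finiteness of the archimedean places). PROVED.
[claim: Mochizuki2012, status: disputed] -/
theorem exists_admissible_superset (S₀ : Finset (Val (fieldOfModuli E))) :
    ∃ S : Finset (Val (fieldOfModuli E)), S₀ ⊆ S ∧ D.IsAdmissibleTruncation S := by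
  classical
  set B : Set (Val (fieldOfModuli E)) :=
    (S₀ : Set (Val (fieldOfModuli E))) ∪ Val.non '' D.VbadMod ∪ {v | v.IsArc} with hB
  have hBfin : B.Finite :=
    (S₀.finite_toSet.union (D.VbadMod_finite.image _)).union (Val.setOf_isArc_finite _)
  set T : Set (Val (fieldOfModuli E)) := Val.restrict ℚ ⁻¹' (Val.restrict ℚ '' B) with hT
  have hTfin : T.Finite :=
    (hBfin.image _).preimage' fun b _ => Val.restrict_rat_fibre_finite b
  have hBT : B ⊆ T := fun v hv => ⟨v, hv, rfl⟩
  refine ⟨hTfin.toFinset, fun v hv => hTfin.mem_toFinset.2 (hBT (Or.inl (Or.inl hv))), ?_, ?_, ?_⟩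
  · intro v hv
    exact hTfin.mem_toFinset.2 (hBT (Or.inl (Or.inr hv)))
  · intro v hv
    exact hTfin.mem_toFinset.2 (hBT (Or.inr hv))
  · intro v w hvw hv
    have hv' : v ∈ T := hTfin.mem_toFinset.1 hv
    obtain ⟨b, hb, hbv⟩ := hv'
    exact hTfin.mem_toFinset.2 ⟨b, hb, hbv.trans hvw⟩

/-- **IUTchI:Def3.1(e)** (kurims p.62) Hence EVERY valuation `v̲ ∈ V̲` of the initial Θ-data lies in the truncation `V̲_S` of some
admissible `S` — the truncated kits of RULING D13 (α) see every place. PROVED. [claim: Mochizuki2012, status: disputed] -/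
theorem exists_admissible_mem_VOver {w : Val K} (hw : w ∈ D.V) :
    ∃ S : Finset (Val (fieldOfModuli E)), D.IsAdmissibleTruncation S ∧
      w ∈ D.VOver (S : Set (Val (fieldOfModuli E))) := by
  obtain ⟨S, hsub, hS⟩ := D.exists_admissible_superset {toVMod F K E w}
  exact ⟨S, hS, hw, Finset.mem_coe.2 (hsub (Finset.mem_singleton_self _))⟩

/-- **IUTchI:Def3.1(e)** (kurims p.62) `V̲` is the UNION of its admissible truncations `V̲_S`. PROVED. [claim: Mochizuki2012, status: disputed] -/
theorem iUnion_VOver_admissible :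
    (⋃ S : {S : Finset (Val (fieldOfModuli E)) // D.IsAdmissibleTruncation S},
      D.VOver ((S : Finset (Val (fieldOfModuli E))) : Set (Val (fieldOfModuli E)))) = D.V := by
  ext w
  simp only [Set.mem_iUnion]
  constructor
  · rintro ⟨S, hwS⟩
    exact hwS.1
  · intro hw
    obtain ⟨S, hS, hwS⟩ := D.exists_admissible_mem_VOver hw
    exact ⟨⟨S, hS⟩, hwS⟩

/-- **IUTchI:Def3.1(e)** (kurims p.62) In particular for every `v̲ ∈ V̲` there is a TRUNCATED KIT (of the toy family, hence some kit)
whose index set contains it: the hypothesis structures `TruncatedKit D S` at admissible `S` jointly cover `V̲`.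
PROVED. [claim: Mochizuki2012, status: disputed] -/
theorem exists_truncatedKit_val_eq {w : Val K} (hw : w ∈ D.V) :
    ∃ (S : Finset (Val (fieldOfModuli E))) (_ : D.IsAdmissibleTruncation S)
      (T : TruncatedKit.{0} D S) (x : T.kit.V), T.val x = w := by
  obtain ⟨S, hS, hwS⟩ := D.exists_admissible_mem_VOver hw
  refine ⟨S, hS, TruncatedKit.toy D S, (TruncatedKit.toy D S).e.symm ⟨w, hwS⟩, ?_⟩
  change (((TruncatedKit.toy D S).e ((TruncatedKit.toy D S).e.symm ⟨w, hwS⟩) : D.VOver _) : Val K) = w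
  rw [Equiv.apply_symm_apply]

end InitialThetaData

end Places

end Literature.IUT.HodgeTheaters
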